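import Mathlib
import Summits.Ventures.PercRepro2.Defs
import Summits.Ventures.PercRepro2.Independence
import Summits.Ventures.PercRepro2.Harris
import Summits.Ventures.PercRepro2.Graph
import Summits.Ventures.PercRepro2.Events
import Summits.Ventures.PercRepro2.BHKEvents
import Summits.Ventures.PercRepro2.R21PinInduction
import Summits.Ventures.PercRepro2.R21PairFrame
import Summits.Ventures.PercRepro2.R21BernAll

/-!
# The cross W-form (XW) behind (CQH) (PercRepro2, p2)

With `a = {s ↔ u}`, `λ = {y ↔ o}`, `S = {s ↔ y}` (and `Q = Sᶜ`, `h = {o ∈ C_s}`), the bilinear form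

  `B_W(p, q) = P_p(aλ) + P_p(Sa)·P_q(Sλ) − P_p(a)·P_q(λ) − P_p(S)·P_q(Saλ)`   (`xwBil`)

has the diagonal `XW(p) = B_W(p, p) = Cov_p(a, λ) − P_p(S)²·Cov_{p(·|S)}(a, λ)`, the Harris
covariance of the two connections restricted to the pairs of configurations not both having
`s ↔ y`: `2·XW(p) = E[(1 − S_X S_Y)(a_X − a_Y)(λ_X − λ_Y)]` for i.i.d. copies `X, Y`.  In the cell's
W-form vocabulary this is `Q D μ (u ∈ ·) Λ` for the cluster law `μ` of `C_s`, `D = ` «not both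
contain `y`» (the status disjointness on `F = {y}`) and `Λ(K) = P(o ∈ C_y | C_s = K)`, which is NOT
monotone in `K` (increasing on the clusters containing `y`, decreasing on the others) — so (XW) is
the «mixed» relative of the cell's W-theorem (`wExt_all`, both functionals monotone), not an instance
of it.  (XW) is the statement `0 ≤ XW(p)` for every admissible weight vector; it is symmetric under
`(s, u) ↔ (y, o)` and tight when `o` hangs off `y` by a single edge (record P2-G22-WFORM.md).

* `cqh_of_xw`: **(CQH) ⟸ (XW)** — the exact identity
  `R − Cov(a, Q ∧ h) = W + [P(Q)·P(Q a h) − P(Q a)·P(Q h)]`, whose bracket is the BHK same-cluster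
  inequality (`bhk_same_cluster_events`, source `s`, avoid `y`, up-sets `{u ∈ ·}`, `{o ∈ ·}`);
  here `R = r21Bil p p` is the (R2-1) slack and (CQH) reads `Cov(a, Q ∧ h) ≤ R`.
* `xxwBil_bernstein`, `xwAnti`, `xxwAnti_bernstein`: the one-edge Bernstein expansion of `B_W` and of
  its antipodal (tensor-Bernstein) coefficients `M^W_F(p) = ∑_η B_W(p[F↦η], p[F↦!η])`, as for
  `r21Bil` / `r21Anti` (R21BernAll.lean).
* `xw_of_xwbern`: **(XW) ⟸ (XW-BERN)** — if every antipodal coefficient at every point mass is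
  nonnegative (the integer statement
  `∑_{ζ ⊆ F} (1 − S_R S_B)(a_R − a_B)(λ_R − λ_B) ≥ 0` over the 2-colourings `R = ζ`, `B = F ∖ ζ`
  of every multigraph, after contracting the open and deleting the closed edges), then (XW) holds
  for every admissible weight vector (pin induction).
-/

namespace Summit.Ventures.PercRepro2

section XWForm

variable {V : Type*} {E : Type*} [Fintype E] [DecidableEq E]
  {R : Type*} [CommRing R] [LinearOrder R] [IsStrictOrderedRing R]

/-- **The bilinear form of (XW)**: `B_W(p, q) = P_p(aλ) + P_p(Sa)·P_q(Sλ) − P_p(a)·P_q(λ) − P_p(S)·P_q(Saλ)`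
with `a = {s ↔ u}`, `λ = {y ↔ o}`, `S = {s ↔ y}`; its diagonal `B_W(p, p)` is the slack of (XW). -/
noncomputable def xwBil (ends : E → Sym2 V) (s y o u : V) (p q : E → R) : R :=
  prob p (connEvent ends s u ∩ connEvent ends y o) +
    prob p (connEvent ends s y ∩ connEvent ends s u) *
      prob q (connEvent ends s y ∩ connEvent ends y o) -
    prob p (connEvent ends s u) * prob q (connEvent ends y o) -
    prob p (connEvent ends s y) *
      prob q (connEvent ends s y ∩ connEvent ends s u ∩ connEvent ends y o)

omit [Fintype E] [DecidableEq E] [LinearOrder R] [IsStrictOrderedRing R] in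
/-- On `{s ↔ y}`, `{s ↔ o}` is `{y ↔ o}`. -/
lemma connEvent_sy_inter_so_xw (ends : E → Sym2 V) (s y o : V) :
    connEvent ends s y ∩ connEvent ends s o = connEvent ends s y ∩ connEvent ends y o :=
  connEvent_inter_connEvent_eq ends s y o

omit [LinearOrder R] [IsStrictOrderedRing R] in
/-- **The one-edge bilinear Bernstein expansion** of `B_W` along `g`. -/
lemma xxwBil_bernstein (ends : E → Sym2 V) (s y o u : V) (p q : E → R) (g : E) :
    xwBil ends s y o u p q =
      (1 - p g) * (1 - q g) *
          xwBil ends s y o u (Function.update p g 0) (Function.update q g 0) +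
        (1 - p g) * q g * xwBil ends s y o u (Function.update p g 0) (Function.update q g 1) +
        p g * (1 - q g) * xwBil ends s y o u (Function.update p g 1) (Function.update q g 0) +
        p g * q g * xwBil ends s y o u (Function.update p g 1) (Function.update q g 1) := by
  unfold xwBil
  rw [prob_eq_pin p (connEvent ends s u ∩ connEvent ends y o) g,
    prob_eq_pin p (connEvent ends s y ∩ connEvent ends s u) g,
    prob_eq_pin p (connEvent ends s u) g,
    prob_eq_pin p (connEvent ends s y) g,
    prob_eq_pin q (connEvent ends s y ∩ connEvent ends y o) g,
    prob_eq_pin q (connEvent ends y o) g,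
    prob_eq_pin q (connEvent ends s y ∩ connEvent ends s u ∩ connEvent ends y o) g]
  ring

end XWForm

section CQH

variable {V : Type*} {E : Type*} [Fintype V] [DecidableEq V] [Fintype E] [DecidableEq E]
  {R : Type*} [CommRing R] [LinearOrder R] [IsStrictOrderedRing R]

/-- **(CQH) from (XW).**  `Cov_p(a, Q ∧ h) ≤ R(p)` (the (R2-1) slack `r21Bil p p`) follows from
`0 ≤ XW(p)` by the exact identity `R − Cov(a, Q ∧ h) = W + [P(Q)P(Qah) − P(Qa)P(Qh)]` and the BHK
same-cluster inequality for the bracket. -/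
theorem cqh_of_xw (p : E → R) (hp : IsProbVec p) (ends : E → Sym2 V) (s y o u : V)
    (hW : 0 ≤ xwBil ends s y o u p p) :
    prob p (connEvent ends s u ∩ clusterInEvent ends s {W : Set V | o ∈ W} ∩
        (connEvent ends s y)ᶜ) -
      prob p (connEvent ends s u) *
        prob p (clusterInEvent ends s {W : Set V | o ∈ W} ∩ (connEvent ends s y)ᶜ) ≤
      r21Bil ends s y o u p p := by
  classical
  -- BHK same cluster: `P(Qa)·P(Qh) ≤ P(Qah)·P(Q)`
  have hbhk := bhk_same_cluster_events p hp ends s y (𝓤 := {W : Set V | u ∈ W})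
    (𝓥 := {W : Set V | o ∈ W}) (fun _ _ h hW => h hW) (fun _ _ h hW => h hW)
  rw [clusterInEvent_mem_eq_connEvent_ycl ends s u] at hbhk
  unfold r21Bil
  rw [clusterInEvent_mem_eq_connEvent_ycl ends s o] at hbhk ⊢
  unfold xwBil at hW
  set S := connEvent ends s y with hS
  set a := connEvent ends s u with ha
  set h := connEvent ends s o with hh
  set l := connEvent ends y o with hl
  -- the S-side identities `S ∩ h = S ∩ l`
  have e1 : S ∩ a ∩ h = S ∩ a ∩ l := by
    rw [Set.inter_right_comm, connEvent_sy_inter_so_xw, Set.inter_right_comm]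
  have e2 : S ∩ h = S ∩ l := connEvent_sy_inter_so_xw ends s y o
  -- decompositions `P(X) = P(X ∩ S) + P(X ∩ Sᶜ)`, with the `S`-sides rewritten
  have hPa : prob p a = prob p (S ∩ a) + prob p (a ∩ Sᶜ) := by
    rw [← prob_inter_add_prob_inter_compl p a S, Set.inter_comm a S]
  have hPl : prob p l = prob p (S ∩ l) + prob p (l ∩ Sᶜ) := by
    rw [← prob_inter_add_prob_inter_compl p l S, Set.inter_comm l S]
  have hPh : prob p h = prob p (S ∩ l) + prob p (h ∩ Sᶜ) := by
    rw [← prob_inter_add_prob_inter_compl p h S, Set.inter_comm h S, e2]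
  have hPal : prob p (a ∩ l) = prob p (S ∩ a ∩ l) + prob p (a ∩ l ∩ Sᶜ) := by
    rw [← prob_inter_add_prob_inter_compl p (a ∩ l) S, Set.inter_comm (a ∩ l) S, ← Set.inter_assoc]
  have hPah : prob p (a ∩ h) = prob p (S ∩ a ∩ l) + prob p (a ∩ h ∩ Sᶜ) := by
    rw [← prob_inter_add_prob_inter_compl p (a ∩ h) S, Set.inter_comm (a ∩ h) S,
      ← Set.inter_assoc, e1]
  have hPS : prob p S = 1 - prob p Sᶜ := by rw [prob_compl, sub_sub_cancel]
  rw [hPa, hPh, hPah]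
  rw [hPal, hPa, hPl, hPS] at hW
  linarith [hW, hbhk]

end CQH


section XWBern

variable {V : Type*} {E : Type*} [Fintype E] [DecidableEq E]
  {R : Type*} [CommRing R] [LinearOrder R] [IsStrictOrderedRing R]

/-- **The antipodal (tensor-Bernstein) coefficient of `B_W`** on the edge set `F`:
`M^W_F(p) = ∑_{η : E → Bool} B_W(p[F ↦ η], p[F ↦ !η])`. -/
noncomputable def xwAnti (ends : E → Sym2 V) (s y o u : V) (p : E → R) (F : Finset E) : R :=
  ∑ η : E → Bool, xwBil ends s y o u (pinOn p F η) (pinOn p F (fun e => !η e))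

omit [LinearOrder R] [IsStrictOrderedRing R] in
/-- `M^W_F` does not see the weight of an edge of `F`. -/
lemma xxwAnti_update_of_mem (ends : E → Sym2 V) (s y o u : V) (p : E → R) {F : Finset E} {g : E}
    (hg : g ∈ F) (c : R) : xwAnti ends s y o u (Function.update p g c) F = xwAnti ends s y o u p F := by
  unfold xwAnti
  simp only [pinOn_update_of_mem p F _ hg c]

omit [LinearOrder R] [IsStrictOrderedRing R] in
/-- `M^W_∅(p) = 2^{|E|}·XW(p)`. -/
lemma xxwAnti_empty (ends : E → Sym2 V) (s y o u : V) (p : E → R) :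
    xwAnti ends s y o u p ∅ = (Fintype.card (E → Bool) : R) * xwBil ends s y o u p p := by
  unfold xwAnti
  have h : ∀ η : E → Bool, pinOn p ∅ η = p := fun η => by
    funext e
    simp [pinOn]
  simp only [h, Finset.sum_const, Finset.card_univ, nsmul_eq_mul]

omit [LinearOrder R] [IsStrictOrderedRing R] in
/-- **The mixed sum is twice the antipodal coefficient of `insert g F`** (for `g ∉ F`). -/
lemma xxwAnti_mixed (ends : E → Sym2 V) (s y o u : V) (p : E → R) {F : Finset E} {g : E}
    (hg : g ∉ F) :
    (∑ η : E → Bool, xwBil ends s y o u (pinOn (Function.update p g 0) F η)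
        (pinOn (Function.update p g 1) F (fun e => !η e))) +
      (∑ η : E → Bool, xwBil ends s y o u (pinOn (Function.update p g 1) F η)
        (pinOn (Function.update p g 0) F (fun e => !η e))) =
      2 * xwAnti ends s y o u p (insert g F) := by
  classical
  let σ : (E → Bool) ≃ (E → Bool) :=
    { toFun := fun η => Function.update η g (!η g)
      invFun := fun η => Function.update η g (!η g)
      left_inv := fun η => by
        simp only [Function.update_self, Bool.not_not, Function.update_idem, Function.update_eq_self]
      right_inv := fun η => by
        simp only [Function.update_self, Bool.not_not, Function.update_idem, Function.update_eq_self] }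
  set f : (E → Bool) → R := fun η => xwBil ends s y o u (pinOn p (insert g F) η)
    (pinOn p (insert g F) (fun e => !η e)) with hf
  have hsum : xwAnti ends s y o u p (insert g F) = ∑ η, f η := rfl
  have hσ : ∑ η, f η = ∑ η, f (σ η) := (Equiv.sum_comp σ f).symm
  have hpt : ∀ η : E → Bool, f η + f (σ η) =
      xwBil ends s y o u (pinOn (Function.update p g 0) F η)
          (pinOn (Function.update p g 1) F (fun e => !η e)) +
        xwBil ends s y o u (pinOn (Function.update p g 1) F η)
          (pinOn (Function.update p g 0) F (fun e => !η e)) := by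
    intro η
    have hσ1 : σ η = Function.update η g (!η g) := rfl
    have e1 : pinOn p (insert g F) η =
        Function.update (pinOn p F η) g (if η g then 1 else 0) := pinOn_insert p F η g
    have e2 : pinOn p (insert g F) (fun e => !η e) =
        Function.update (pinOn p F (fun e => !η e)) g (if !η g then 1 else 0) :=
      pinOn_insert p F _ g
    have e3 : pinOn p (insert g F) (σ η) =
        Function.update (pinOn p F η) g (if !η g then 1 else 0) := by
      rw [hσ1, pinOn_insert, pinOn_update_eta_of_notMem p F η hg, Function.update_self]
    have e4' : (fun e => !(σ η e)) = Function.update (fun e => !η e) g (η g) := by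
      funext e
      by_cases he : e = g
      · subst he
        simp [hσ1]
      · simp [hσ1, Function.update_of_ne he]
    have e4 : pinOn p (insert g F) (fun e => !(σ η e)) =
        Function.update (pinOn p F (fun e => !η e)) g (if η g then 1 else 0) := by
      rw [e4', pinOn_insert, pinOn_update_eta_of_notMem p F _ hg, Function.update_self]
    simp only [hf, e1, e2, e3, e4, pinOn_update_of_notMem p F _ hg]
    cases hη : η g <;> simp [add_comm]
  calc (∑ η : E → Bool, xwBil ends s y o u (pinOn (Function.update p g 0) F η)
          (pinOn (Function.update p g 1) F (fun e => !η e))) +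
        (∑ η : E → Bool, xwBil ends s y o u (pinOn (Function.update p g 1) F η)
          (pinOn (Function.update p g 0) F (fun e => !η e)))
      = ∑ η : E → Bool, (f η + f (σ η)) := by
        rw [← Finset.sum_add_distrib]
        exact Finset.sum_congr rfl fun η _ => (hpt η).symm
    _ = ∑ η, f η + ∑ η, f (σ η) := Finset.sum_add_distrib
    _ = 2 * xwAnti ends s y o u p (insert g F) := by rw [← hσ, hsum]; ring

omit [LinearOrder R] [IsStrictOrderedRing R] in
/-- **The one-edge Bernstein expansion of the antipodal coefficient**: for `g ∉ F`,
`M^W_F(p) = (1 − p_g)²·M^W_F(p[g↦0]) + 2·p_g(1 − p_g)·M^W_{F ∪ {g}}(p) + p_g²·M^W_F(p[g↦1])`. -/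
lemma xxwAnti_bernstein (ends : E → Sym2 V) (s y o u : V) (p : E → R) {F : Finset E} {g : E}
    (hg : g ∉ F) :
    xwAnti ends s y o u p F =
      (1 - p g) ^ 2 * xwAnti ends s y o u (Function.update p g 0) F +
        2 * (p g * (1 - p g)) * xwAnti ends s y o u p (insert g F) +
        p g ^ 2 * xwAnti ends s y o u (Function.update p g 1) F := by
  have e1 : ∀ η : E → Bool, xwBil ends s y o u (pinOn p F η) (pinOn p F (fun e => !η e)) =
      (1 - p g) * (1 - p g) * xwBil ends s y o u (pinOn (Function.update p g 0) F η)
          (pinOn (Function.update p g 0) F (fun e => !η e)) +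
        (1 - p g) * p g * xwBil ends s y o u (pinOn (Function.update p g 0) F η)
          (pinOn (Function.update p g 1) F (fun e => !η e)) +
        p g * (1 - p g) * xwBil ends s y o u (pinOn (Function.update p g 1) F η)
          (pinOn (Function.update p g 0) F (fun e => !η e)) +
        p g * p g * xwBil ends s y o u (pinOn (Function.update p g 1) F η)
          (pinOn (Function.update p g 1) F (fun e => !η e)) := by
    intro η
    rw [xxwBil_bernstein ends s y o u _ _ g]
    simp only [pinOn_apply_of_notMem p F _ hg, pinOn_update_of_notMem p F _ hg]
  have hmix := xxwAnti_mixed ends s y o u p hg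
  unfold xwAnti at hmix ⊢
  rw [Finset.sum_congr rfl fun η _ => e1 η]
  simp only [Finset.sum_add_distrib, ← Finset.mul_sum]
  linear_combination (p g * (1 - p g)) * hmix

/-- **(XW) from (XW-BERN).**  If every antipodal coefficient of `B_W` at every point mass is
nonnegative — `0 ≤ M^W_F(p)` for every `p ∈ {0,1}^E` and every edge set `F` (the integer
statement `∑_{ζ ⊆ F} (1 − S_R S_B)(a_R − a_B)(λ_R − λ_B) ≥ 0` over the 2-colourings of every
multigraph) — then `0 ≤ XW(p)` for every admissible weight vector. -/
theorem xw_of_xwbern (ends : E → Sym2 V) (s y o u : V)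
    (hB : ∀ p : E → R, IsProbVec p → (∀ e, p e = 0 ∨ p e = 1) →
      ∀ F : Finset E, 0 ≤ xwAnti ends s y o u p F) :
    ∀ p : E → R, IsProbVec p → 0 ≤ xwBil ends s y o u p p := by
  have key : ∀ p : E → R, IsProbVec p → ∀ F : Finset E, 0 ≤ xwAnti ends s y o u p F := by
    refine pin_induction (fun p : E → R => ∀ F : Finset E, 0 ≤ xwAnti ends s y o u p F) hB ?_
    intro p hp hex
    obtain ⟨g, hg0, hg1⟩ := hex
    refine ⟨g, hg0, hg1, fun h0 h1 F => ?_⟩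
    by_cases hgF : g ∈ F
    · rw [← xxwAnti_update_of_mem ends s y o u p hgF 0]
      exact h0 F
    · rw [xxwAnti_bernstein ends s y o u p hgF]
      have h2 : 0 ≤ xwAnti ends s y o u p (insert g F) := by
        rw [← xxwAnti_update_of_mem ends s y o u p (Finset.mem_insert_self g F) 0]
        exact h0 (insert g F)
      have hq0 := hp.nonneg g
      have hq1 := hp.le_one g
      have ha : 0 ≤ (1 - p g) ^ 2 * xwAnti ends s y o u (Function.update p g 0) F :=
        mul_nonneg (sq_nonneg _) (h0 F)
      have hb : 0 ≤ 2 * (p g * (1 - p g)) * xwAnti ends s y o u p (insert g F) :=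
        mul_nonneg (mul_nonneg (by norm_num) (mul_nonneg hq0 (by linarith))) h2
      have hc : 0 ≤ p g ^ 2 * xwAnti ends s y o u (Function.update p g 1) F :=
        mul_nonneg (sq_nonneg _) (h1 F)
      linarith
  intro p hp
  have h := key p hp ∅
  rw [xxwAnti_empty] at h
  have hcard : (0 : R) < (Fintype.card (E → Bool) : R) := by
    exact_mod_cast Fintype.card_pos
  rcases lt_or_ge (xwBil ends s y o u p p) 0 with hneg | hpos
  · exfalso
    have := mul_neg_of_pos_of_neg hcard hneg
    linarith
  · exact hpos

end XWBern

/-- **(CQH) for every admissible weight vector from (XW-BERN)** (the two frames composed). -/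
theorem cqh_of_xwbern {V : Type*} {E : Type*} [Fintype V] [DecidableEq V] [Fintype E]
    [DecidableEq E] {R : Type*} [CommRing R] [LinearOrder R] [IsStrictOrderedRing R]
    (ends : E → Sym2 V) (s y o u : V)
    (hB : ∀ p : E → R, IsProbVec p → (∀ e, p e = 0 ∨ p e = 1) →
      ∀ F : Finset E, 0 ≤ xwAnti ends s y o u p F) :
    ∀ p : E → R, IsProbVec p →
      prob p (connEvent ends s u ∩ clusterInEvent ends s {W : Set V | o ∈ W} ∩
          (connEvent ends s y)ᶜ) -
        prob p (connEvent ends s u) *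
          prob p (clusterInEvent ends s {W : Set V | o ∈ W} ∩ (connEvent ends s y)ᶜ) ≤
        r21Bil ends s y o u p p :=
  fun p hp => cqh_of_xw p hp ends s y o u (xw_of_xwbern ends s y o u hB p hp)

end Summit.Ventures.PercRepro2
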